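import Mathlib
import HarnessLib
import HarnessLib.Audit
import Summits.ABC.Statement
import Literature.NumberTheory.EllipticCurves.Szpiro
import Literature.NumberTheory.EllipticCurves.ModularCurve
import Literature.NumberTheory.Automorphic.BrandtXi
import Literature.NumberTheory.EllipticCurves.Isogeny
import HarnessLib.Audit.Status.Attr

/-!
Route: DefiniteXi

Route DefiniteXi — realises idea card ABC/ABC/definite-quaternion-xi-szpiro ("quarantine
level-lowering on a DEFINITE quaternion algebra").

THESIS X (it suffices to show) = FreyDegreeBound, Frey's degree conjecture on Frey–Hellegouarch
curves: for every ε > 0 there is C such that for all coprime integers a, b with ab(a+b) ≠ 0 the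
curve E_(a,b): y² = x(x−a)(x+b) of conductor N has a modular parametrisation X₀(N) → E_(a,b) of
degree ≤ C·N^(2+ε). X → ABC is the frame pair PeterssonLowerBound (‖f_E‖² ≫_ε N^(1−ε),
Hoffstein–Lockhart 1994 / Murty 1999; verbatim the tree fact murty_petersson_newform_lower_bound,
filed as an ITEM) + DegreeBoundToABCOfPetersson (Frey 1989, Mai–Murty 1994, Murty 1999 Thm 1:
Zagier's identity 4π²c²(f,f) = deg·covol Λ, Silverman's covolume inequality (proved in tree) and rad
∣ 2N; PROVABLE NOW as the one-liner `abcLt_of_freyDegreeBound hP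
silverman1986_discriminant_c4_covolume_holds`, DegreeConjectureAbc.lean).

Lean (elaborates; imports Literature.NumberTheory.EllipticCurves.Szpiro + .ModularCurve +
Literature.NumberTheory.Automorphic.BrandtXi):
∀ ε : ℝ, 0 < ε → ∃ C : ℝ, ∀ a b : ℤ, IsCoprime a b → a * b * (a + b) ≠ 0 → ∀ (N : ℕ) [NeZero N],
(Literature.NumberTheory.EllipticCurves.freyCurve a b).conductorNorm ℤ = N → ∃ D :
Literature.NumberTheory.EllipticCurves.ModularForms.ModularParametrizationData
(Literature.NumberTheory.EllipticCurves.freyCurve a b) N, (D.deg : ℝ) ≤ C * (N : ℝ) ^ (2 + ε)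

LINE OF ATTACK (rev 12, judge-pass repair 2026-08-16: the deciding theorem now runs through two NEW
cruxes, EisensteinQuarantine r5 and SteinbergCore r6, neither abc-equivalent, whose conjunction is
the former binder XiStrongBound r4 by pure algebra; XiBound r2 is the weak rung; everything TYPED
over the landed definition Literature.NumberTheory.Automorphic.brandtXi): move the Frey newform f_E
to the definite quaternion algebra of discriminant N⁻ (N⁻ | N odd, squarefree, ω(N⁻) odd; N⁺ =
N/N⁻). Its Jacquet–Langlands line in the Brandt module ℤ[Cl(O_(N⁺,N⁻))] has a primitive integral
generator φ; ξ(E;N⁺,N⁻) := Σ_i w_i φ_i² = brandtXi N⁺ N⁻ (a_n(E)) (an integer: φ is a common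
eigenvector of Pizer's Brandt matrices = adjacency matrices of Ramanujan graphs on ≈ N/12 vertices).
Ribet–Takahashi 1997 / Takahashi 2001 Thm 2.3+3.8 / Khare 2003 / Pollack–Weston 2011 Thm 6.8: deg
φ_E ≐ η_f(N) = ξ(E;N⁺,N⁻) · ∏_(q|N⁻) v_q(Δ_E) · γ, γ a rational unit supported at Eisenstein primes
(for Frey curves ⊆ {2,3}), num(γ) ≤ 163^ω(N⁻) (Pasten Thm 6.1; tree fact takahashi2001_thm_2_3 for
N⁻ prime). Level-lowering congruences at q | N⁻ are ABSENT from ξ by construction (no q-old forms in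
the N⁻-new Brandt module); those at the non-quarantined bad primes q | N⁺ (q = 2 always among them
when 2 | N) remain inside ξ with order v_q(Δ)·(unit). The abc-equivalent bound XiStrongBound
(ξ·∏_(q|N⁻) v_q(Δ_min) ≤ C_ε N^(2+ε), every admissible N⁻) is therefore split along the primes ℓ
dividing ξ, NOT along ξ × T as route RibetTakahashiSplit does:
  EisensteinQuarantine (A, abc-FREE): sixPart ξ := 2^(v₂ξ)·3^(v₃ξ) ≤ C_ε N^ε · ∏_(q|N, q∤N⁻)
v_q(Δ_min) — the {2,3}-part of the quarantined congruence number is no larger than the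
level-lowering content of the non-quarantined primes: an INDEX statement about the 2- /3-adic
Eisenstein component of the N⁻-new Hecke algebra of level 2^k·N_odd (Mazur / Ohta / Yoo index
formulas, Calegari–Emerton and Wake–Wang-Erickson rank criteria; Katz 1980 + Mazur bound the
congruence with the Eisenstein vector itself by 2⁴), not implied by abc and not implying it;
  SteinbergCore (B, abc-strength): coprimeSixPart ξ · ∏_(q|N) v_q(Δ_min) ≤ C_ε N^(2+ε) — the
prime-to-6 part of ξ (for ℓ ≥ 5 ρ̄_(E,ℓ) is irreducible on every Frey curve by Mazur–Kenku, so
ξ[ℓ^∞] is a Steinberg-at-N⁻ adjoint Selmer length, Diamond 1997 / Böckle–Khare–Manning) times the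
FULL exponent product; implied by abc, immune to the Eisenstein-unit corner (γ is a {2,3}-unit), and
folding ∏_(q|N) v_q in is what lets A ∧ B close without RibetTakahashiSplit's T-half;
  A ∧ B ⟹ XiStrongBound (sixPart·coprimeSixPart = ξ and ∏_(q|N) = ∏_(q|N,q∤N⁻) · ∏_(q|N⁻); 35 lines,
inlined in `closes`)  ∧  DefiniteRTControlPrime (deg_min φ_E ≤ C_ε N^ε · ξ(N/q,q) · v_q(Δ_E) for odd
primes q ∣ N: KNOWN, the definite Ribet–Takahashi comparison)  ⟹ (DefiniteGlue, PROVED: take N⁻ =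
one odd prime q | N; the six coprime pairs with ab(a+b) = ±2^k are absorbed in C)  the degree bound
for MINIMAL data  ⟹ (FreyModularity + MinimalBoundGivesTarget, the latter PROVED)  X,
with the weak rung XiBound (ξ ≤ C N^A) ⟺ PolyFreyDegree ⟺ polynomial Szpiro on Frey curves
(PolyDegreeToPolyABC, PROVED, records the polynomial abc it yields). DECIDING THEOREM (elaborates,
axioms whitelist; native check 2026-08-16): closes (EisensteinQuarantine) (SteinbergCore)
(DefiniteRTControlPrime) (DefiniteGlue) (FreyModularity) (MinimalBoundGivesTarget)
(PeterssonLowerBound) (DegreeBoundToABCOfPetersson) : ABC := [hXS : XiStrongBound from A, B by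
algebra]; hDeg hP (hMin hMod (hGlue hXS hRT)). RELATION TO route RibetTakahashiSplit (whose ξ-half
R3′ = WeightedSzpiroBound is PROVED equivalent to ABC in the tree, WeightedSzpiroBound.iff_abc, and
is reached from this route's XiStrongBound ∧ DefiniteRTControlPrime ∧ FreyModularity ∧
PeterssonLowerBound by the landed WeightedSzpiroBound.of_definiteXi): the binder A is genuinely
disjoint from that ξ-half — WSB ⟺ abc neither implies nor follows from A — and B is strictly weaker
than it; RTSplit factors deg φ = ξ_max × T(E) and stakes T ≤ N^ε (R2/R4, indefinite Shimura curves,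
Petersson LOWER bounds for integral JL forms), this route factors the same number as (6-part) ×
(prime-to-6 part) on the definite side and stakes the Eisenstein quarantine. History: the former
crux SmallPrimePartOfDegree ({2,3}-part of deg_min ≤ N^ε on X₀(N)) was DROPPED 2026-08-15 as
census-suspect (kit j000054/j000169: {2,3}-part ≈ N^(0.65–1.17), N ≤ 8736); A differs from it
exactly by the quarantine and the allowance — the level-lowering 2-parts Σ_q v₂(v_q(Δ)) and the
Atkin–Lehner 2^(ω(N)) that made that census large are absent from ξ for q | N⁻ and paid for by
∏_(q∤N⁻) v_q otherwise (crux-programme census kit j007194/j012194/j012877/j013104: at maximal N⁻,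
v₂(ξ) = ω(N⁻) + v₂(v₂(Δ_min)) + ρ with ρ ≤ 3 on the very curves where deg looked worst).

Rationale: WHY THIS LINE. Every modular attack on Szpiro bounds deg φ_E through congruences of f_E in S₂(Γ₀(N))
and pays for ALL level-lowering congruences (Ribet: f ≡ q-old form mod ℓ iff ℓ | v_q(Δ_E)) — i.e.
for the very quantity one wants to bound. On the definite algebra of discriminant N⁻ those
congruences do not exist: η_f(N) = ξ(E;N⁺,N⁻)·∏_(q|N⁻) v_q(Δ_E)·γ (doi:10.1112/s0010437x11005318 Thm
6.8, from doi:10.1073/pnas.94.21.11110 Thm 1, doi:10.1006/jnth.2000.2614 Thm 2.3/3.8 and Khare 2003;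
hypotheses weakened in arXiv:2108.09729), the factor ∏ v_q(Δ_E) is POLYNOMIAL by a proved theorem
(arXiv:1705.09251 Thm 16.8 = tree fact pasten2024_thm_2_5), γ is controlled (arXiv:1705.09251 Thm
6.1: num γ ≤ 163^ω), and what is left, ξ = Σ w_i φ_i² = brandtXi, is the squared length of an
INTEGER common eigenvector of Pizer's Brandt matrices on a finite set — no Petersson/Arakelov lower
bound is needed on that side (⟨φ,φ⟩ ≥ 1 for free; on the indefinite side this is Pasten's hardest
input, his Thm 1.6). Imported areas: definite quaternionic forms / Jacquet–Langlands (Gross 1987;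
Emerton doi:10.1090/s0894-0347-02-00390-9), Ramanujan-graph spectral structure (Pizer), R = T /
adjoint Selmer (Diamond's numerical criterion: ℓ-part of ξ = length of the adjoint Selmer group of
ρ_(E,ℓ), Steinberg at N⁻, minimal at N⁺; arXiv:2108.09729). Catalogue used: spectral/graph
reformulation + arithmetic (Selmer) control; no physical analogy. Added by the 2026-08-16 repair:
Eisenstein-ideal theory at ℓ = 2, 3 (Mazur1977, Ohta2014, Yoo2015, CalegariEmerton2005,
WakeWangErickson2020; Katz1980 for the Eisenstein-vector congruence) is imported to carry the
abc-free half A of the split, and the crux programme's censuses (kit j007194/j012194,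
j012877/j013104, j013237/j013418) calibrate it.
TYPED LAYER (rev 12; imports Szpiro + ModularCurve + Automorphic.BrandtXi; dependency cone free of
unproved Literature facts): target X = FreyDegreeBound; cruxes XiBound (r2, weak rung),
DefiniteRTControlPrime (r3, known in print), XiStrongBound (r4, abc-equivalent; = A ∧ B),
EisensteinQuarantine (r5, NEW, abc-free, binder of closes), SteinbergCore (r6, NEW, abc-strength,
binder of closes), PeterssonLowerBound and FreyModularity (r9 cruxes: true-in-print formal debt that
closes consumes); supports DefiniteGlue (PROVED, definiteGlue_holds), MinimalBoundGivesTarget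
(PROVED), DegreeBoundToABCOfPetersson (PROVED), Assembly (PROVED, legacy mirror of the rev-5
closes), PolyFreyDegree + PolyDegreeToPolyABC (weak rung; the latter PROVED), XiBoundUpgrade (ladder
glue XiBound → XiStrongBound, abc-hard residual, kept because a landed Theorems file analyses it).
Dropped in this repair to respect the 15-item cap: FreyValuationBound (Stewart–Tijdeman input of the
weak rung, stated inline where used) and ExponentProductFrey (Pasten's product theorem, tree fact
pasten2024_thm_2_5; its product now sits inside SteinbergCore). Deciding theorem: closes (hEis :
EisensteinQuarantine) (hCore : SteinbergCore) (hRT : DefiniteRTControlPrime) hGlue hMod hMin hP hDeg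
: ABC := (XiStrongBound from hEis, hCore by algebra, inline) ▸ hDeg hP (hMin hMod (hGlue hXS hRT)).
RANKED CRUXES. #2 XiBound (∃A: ξ(E;N/N⁻,N⁻) ≤ C N^A; ⟺ polynomial Szpiro on Frey curves via
Takahashi 2.3/3.8 + Stewart–Tijdeman; live crux chain, lead on line two-adic-redei-depth whose
load-bearing stub is the 2-adic half of #5; why it might fail: false iff an abc family has log c/log
rad → ∞; source doi:10.1006/jnth.2000.2614, arXiv:1705.09251). #3 DefiniteRTControlPrime (the
definite Ribet–Takahashi comparison at N⁻ = q prime, KNOWN: Takahashi2001 Thm 2.3/3.8, formal debt;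
why it might fail: only as typed — isogeny transport optimal ↦ E_(a,b), Eichler setup). #4
XiStrongBound (ξ·∏_(q|N⁻) v_q ≤ C N^(2+ε); abc-equivalent given #3; now = #5 ∧ #6 by algebra, kept
as the parent statement and for its live line SplitProof; why it might fail: abc-strength; corner
N/N⁻ = 2^k, den γ ≤ κ^ω·D only; source Masser1990, arXiv:1705.09251). #5 EisensteinQuarantine (NEW,
binder; sixPart ξ ≤ C_ε N^ε·∏_(q|N,q∤N⁻) v_q(Δ_min): abc-FREE index statement on the 2- /3-adic
Eisenstein component of the N⁻-new Hecke algebra; why it might fail: Hadamard regime of many even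
unramified branches ≡ f_E, deep wild 2-adic towers at composite level, census drift 0.35–0.5
bit/doubling for curves bad at 2, 2-power denominators of γ in the corner; sources
CalegariEmerton2005, Yoo2015, Ohta2014, WakeWangErickson2020, Katz1980, Mazur1977,
PollackWeston2011). #6 SteinbergCore (NEW, binder; coprimeSixPart ξ · ∏_(q|N) v_q(Δ_min) ≤ C_ε
N^(2+ε): abc-strength, implied by abc, immune to the γ-corner, for ℓ ≥ 5 a Steinberg adjoint-Selmer
product bound; why it might fail: quality > 1 families, exponent 2 sharp (Masser1990); sources
Diamond1997, arXiv:2108.09729, Takahashi2001, Kenku1982). #9 PeterssonLowerBound, FreyModularity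
(true in print; Hoffstein–Lockhart; Wiles/BCDT). SUPPORT: as in TYPED LAYER.
KILL CRITERIA. (a) Brandt-module census at maximal N⁻ and at N⁻ = q (kit/brandt.gp of the crux
programme, validated on (1,11), (1,37), (16,3); Frey curves N ≤ 2·10⁴): v₂(ξ) − Σ_(q|N⁺ odd)
v₂(v_q(Δ_min)) − v₂(v₂(Δ_min)) growing like θ·log₂ N with θ ≥ 0.3 across [2^11, 2^15] kills #5 as
stated (the line then shrinks to 'structure of ξ[2]' and B ∧ census; tenure decides); (b)
log(coprimeSixPart(deg_min)·∏v_q)/log N drifting above 2 on Frey curves (PARI ellmoddegree +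
valuations, no Brandt code needed at N⁻ = q by Takahashi) kills #6, #4, X and abc on Frey curves
alike; (c) a theorem that den γ reaches N^δ at ℓ = 2 in the corner N/N⁻ = 2^k kills #5 (and #4) AS
STATED for composite N⁻ — repair: restrict N⁻ so that N/N⁻ has an odd prime, or route closes through
the prime-level glue (Theorems/DefiniteXiXiBoundUpgrade.lean (E)); #6 is untouched by (c). (d) FIRED
earlier: the X₀(N)-side {2,3}-census (j000054/j000169) killed SmallPrimePartOfDegree, not #5
(quarantine + allowance absorb exactly the parts that census measured). Consistency: exponent 2 in
#4/#6/X is sharp (Masser1990).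
NOT DECOMPOSED YET. #5 ← (EisTame: ≤ C^ω(N) branches of the 2-adic Eisenstein component meet the
rational branch of f_E, each boundedly wild) + (the fixed-shape law v₂(ξ) ≤ Σ_(q|N⁺ odd) v₂(v_q) +
v₂(v₂Δ) + B·ω(N) + B) + the 3-adic twin on the X₀(12)-family — lines of the crux programme, not
items; #6 ← adjoint-Selmer product control at ℓ ≥ 5 (Diamond–Flach–Guo / BKM defect) — no split is
proposed before a handle exists; the choice of N⁻ inside DefiniteGlue (one odd prime q) versus
maximal N⁻ (allowance of #5 smallest); a prime-N⁻ restatement of #4/#5 if kill criterion (c) fires;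
the weak-rung analogue (#5 ∧ 'coprimeSixPart ξ ≤ C N^A' ⟹ XiBound).
CHEAPEST FALSIFIER. For the new binder #5: extend the crux programme's direct-ξ census
(kit/brandt.gp, j012877/j013104: four curves so far, all fitting v₂(ξ) = ω(N⁻) + v₂(v₂(Δ_min)) + ρ,
ρ ≤ 3) to the ≈ 40 top-residual Frey curves of j012194 with N ≤ 2·10⁴ at maximal N⁻ and at N⁻ = q —
one batched kit job, minutes per level at h ≤ 250; a residual ρ growing with N kills #5. For #6
nothing is cheaper than an abc-quality census (it is implied by abc).
NOVELTY / BARRIERS: see those fields (searches run 2026-08-15/16; refuter novelty grade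
new-combination, 5 passes; the A/B split is recorded as delta (d) in Novelty).

Novelty: Prior art (searches 2026-08-15: crossref RT/PW/ARS/Murty; zbMATH 'Shimura curves abc modular degree'
(10 rows, none definite); local hybrid; lit read arXiv:1705.09251 pp.5–9,20,49; galaxy rc 75; +
card's audited searches). (1) arXiv:1705.09251 (Pasten 2024): Shimura-curve degrees δ_(D,M),
INDEFINITE D only; bounds the RATIOS δ_(1,N)/δ_(D,M) (Thm 1.5, γ controlled incl. ℓ=2) and says p.9
that bounding δ_(D,M) itself polynomially 'seems out of reach (would imply Szpiro)'; hardest input: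
Petersson LOWER bound for integral quaternionic forms (Thm 1.6). (2) doi:10.1112/s0010437x11005318 =
arXiv:math/0610694 (Pollack–Weston 2011) §2, Thm 6.8: definite congruence number ξ_f(N⁺,N⁻) =
⟨φ_f,φ_f⟩, η_f(N) = ξ·∏c_q up to Eisenstein primes; for μ-invariants, never Szpiro. (3)
doi:10.1073/pnas.94.21.11110, doi:10.1006/jnth.2000.2614, arXiv:2108.09729,
doi:10.1090/pspum/066.1/1703750, Prasanna 2006 (RT + Frey's equation, Eisenstein primes omitted;
Pasten p.49). DELTA: Frey form on the DEFINITE algebra, so that (a) level-lowering at q | N⁻ is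
discharged by PROVED theorems (Pasten's product bound / Stewart–Yu), (b) the residue ξ is the norm
of an integer Brandt eigenvector on a finite set where the Petersson lower bound is trivial (⟨φ,φ⟩ ≥
1): unconditional 'poly-Szpiro on Frey curves ⟺ XiBound', 'abc ⟺ XiStrongBound ∧ DefiniteRTControl';
(c) the definite twin of Pasten Thm 1.5 (2-part of the RT–PW comparison) isolated as a crux —
treated nowhere in print. Claimed grade: new-combination.  [refs: 10.1112/s0010437x11005318, 10.1073/pnas.94.21.11110, 10.1006/jnth.2000.2614, 10.1090/pspum/066.1/1703750, 1705.09251, math/0610694, 2108.09729, doi:10.1112/s0010437x11005318, doi:10.1073/pnas.94.21.11110, doi:10.1006/jnth.2000.2614, doi:10.1090/pspum/066.1/1703750]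

Barriers (technique_class: definite-quaternion-congruence-number brandt-module): technique_class: definite-quaternion-congruence-number brandt-module
Literature.Barriers.ABC.SzpiroEpsilonCannotBeDropped: respected — XiStrongBound and X keep the ε
(exponent 2+ε; Masser1990's curves have ξ·∏v_q = N²·exp(O(√log N)), consistent); XiBound is a
polynomial statement untouched by it.
Literature.Barriers.ABC.EpsilonCannotBeDropped: respected for the same reason (the assembly goes
through generalized Szpiro 6+ε, never an ε-free abc).
Literature.Barriers.ABC.BakerMethodBounds: not in the class (no linear forms in logarithms); it is
the benchmark the weak rung must beat (XiBound ⟹ log|Δ| ≪ log N versus Stewart–Yu's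
rad^(1/3)(log)³); Stewart–Tijdeman/Stewart–Yu enter only as the trivial input v_q(Δ) ≤ N^(O(1)).
Literature.Barriers.ABC.IUTDisputedClaim: nothing imported from IUT.
Literature.Barriers.ABC.IntegersHaveNoDerivation: not engaged — no function-field transfer;
Papikian's F_q(T) degree engine is cited only to locate the crux (cusp forms' Fourier control,
absent on the cuspless definite side).
Literature.Barriers.ABC.UniformABCImpliesNoSiegelZeros: not triggered — everything is over ℚ, no
uniformity over number fields is claimed (the Petersson lower bound inside DegreeBoundToABC is the
Siegel-zero-free symmetric-square bound of Hoffstein–Lockhart–GHL, a theorem).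
Negatives index (ledger negatives --problem ABC, 2026-08-15): 0 refuted statements; nothing here
restates one.

Novelty grade: new-combination — ROUTE REVIEW gen-1 (refuter 5830665c, 2026-08-15T13:55Z; 5th pass, CONCUR with 120149d4/4d27b3f2/d6c52f0b; deltas only; full text review_DefiniteXi.txt in my folder). Re-verified: 8 typed decls rc0; Assembly + MinimalBoundGivesTarget PROVED sorry-free (evidence ProofMinimalBoundGivesTarget.lean now  (refuter refuter-rreview-route-ABC-DefiniteXi-rou-5830665c-0, 2026-08-15T13:49:07Z; prior: route-ABC-QuaternionicDegree, route-ABC-RibetTakahashiSplit, doi:10.1112/s0010437x11005318, arXiv:1705.09251, doi:10.1073/pnas.94.21.11110, doi:10.1016/j.jnt.2012.08.024)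

History (route lifecycle, newest last):
- 2026-08-15T16:55:59Z · rev 4: dropped SmallPrimePartOfDegree, FreyParametrizationExists — route-repair g4 step A/3 (planner 2026-08-15): import Literature.NumberTheory.Automorphic.BrandtXi (brandtXi LANDED, BrandtXi.lean:547) so the blocked signature (planner-rbadge-ABC-DefiniteXi-3cf49fd7-g4-0)
- 2026-08-15T17:08:17Z · rev 5: restated XiBound (stmt-ABC-2021), XiStrongBound (stmt-ABC-2023), DefiniteRTControl (stmt-ABC-2022), Assembly (stmt-ABC-2020) — route-repair g4 step B+C (planner 2026-08-15; step A = rev 4 already made the route deciding-theorem-OK and STAFFABLE: deps 62 consts, 0 unproved). This edit wi (planner-rbadge-ABC-DefiniteXi-3cf49fd7-g4-0)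
- 2026-08-15T17:08:17Z · rev 5: dropped DegreeBoundToABC — route-repair g4 step B+C (planner 2026-08-15; step A = rev 4 already made the route deciding-theorem-OK and STAFFABLE: deps 62 consts, 0 unproved). This edit wi (planner-rbadge-ABC-DefiniteXi-3cf49fd7-g4-0)
- 2026-08-16T02:17:40Z · AUTO-CRUX: 1 conjecture-grade item(s) promoted to crux (FreyDegreeBound) — refuter vetting / tiering apply (operator:999:1362873)
- 2026-08-16T07:25:16Z · rev 10: dropped FreyValuationBound, ExponentProductFrey — route-repair (judge pass 06:45Z, tier C: 'a crux statement genuinely disjoint from RTSplit's xi-half'), step 1/3 — free two slots under the 15-item cap for the (planner-rrepair-ABC-DefiniteXi-judge-fb38d020-0)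
- 2026-08-26T05:03:18Z · DORMANT — reconciler: no traction for 8.4 d (last activity item-evidence-added at 2026-08-17T19:28:03Z); parked, not closed — `ledger route dormant route-ABC-DefiniteXi - (operator:999:1852333)
- 2026-08-27T22:25:57Z · REACTIVATED — reconciler: reactivated — activity statement-checked at 2026-08-27T21:04:38Z after parking at 2026-08-26T05:03:18Z (operator:999:1697315)

sub-problem: ABC · status: open · opened planner-plancard-ABC-ABC-definite-quaternion--cda25d97-0 2026-08-15T11:00:18Z · rev 23 · ledger route-ABC-DefiniteXi
GENERATED by the gate from the ledger (D-0016/17). Provers cite these decls: `theorem foo : Summit.ABC.ABC.Theses.DefiniteXi.<Decl> := …` in Summits/ABC/ABC/Theorems/<Name>.lean.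
-/

namespace Summit.ABC.ABC.Theses.DefiniteXi

open scoped BigOperators Topology Manifold Classical MeasureTheory ProbabilityTheory Matrix InnerProductSpace ComplexConjugate ContinuousMap
open Filter Set Function TopologicalSpace MeasureTheory

attribute [summit_statement] _root_.ABC

open Literature.Abc

/-- item stmt-ABC-2019 · target · rank 0 · open · by planner
why it might fail: Equivalent to abc on Frey curves: X ⟹ abc (Murty 1999); abc ⟹ X via ‖f_E‖² ≪ N^(1+ε) and bounded Manin constant (Pasten Thm 1.3, S={2}). False iff some family of abc triples has limsup quality > 1. Exponent 2 is sharp (Masser 1990 ⟹ deg φ ≥ N^(2−o(1)) infinitely often).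
sources: doi:10.1090/pspum/066.1/1703750, doi:10.1007/bfb0086544, zbl:0822.11047, Masser1990, ZagierCMB1985, PastenShimura2024
[target] Thesis X: Frey's degree conjecture restricted to Frey–Hellegouarch curves E_(a,b): y² =
x(x−a)(x+b), a,b coprime, ab(a+b) ≠ 0: the minimal modular degree over X₀(N), N = conductorNorm (N |
2⁸·rad(ab(a+b)), tree fact conductorNorm_freyCurve_dvd), is ≤ C_ε N^(2+ε). `∃ D :
ModularParametrizationData (freyCurve a b) N, D.deg ≤ …` reads 'some parametrisation of that degree
exists' (modularity, BCDT, supplies inhabitants: nonempty_modularParametrizationData; a level N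
carrying such data is the conductor). The route attacks X on the definite quaternion algebra: X ⟸
XiStrongBound ∧ DefiniteRTControl (see those items); X → ABC is DegreeBoundToABC. -/
@[route_item "route-ABC-DefiniteXi", crux]
def FreyDegreeBound : Prop :=
  ∀ ε : ℝ, 0 < ε → ∃ C : ℝ, ∀ a b : ℤ, IsCoprime a b → a * b * (a + b) ≠ 0 → ∀ (N : ℕ) [NeZero N], (Literature.NumberTheory.EllipticCurves.freyCurve a b).conductorNorm ℤ = N → ∃ D : Literature.NumberTheory.EllipticCurves.ModularForms.ModularParametrizationData (Literature.NumberTheory.EllipticCurves.freyCurve a b) N, (D.deg : ℝ) ≤ C * (N : ℝ) ^ (2 + ε)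

/-- item stmt-ABC-11338 · crux · rank 3 · open · by planner
why it might fail: KNOWN in print, UNPROVED in tree (formal debt): Takahashi 2001 Thm 2.3/3.8 give δ·i = ξ·j, i·j = v_q(Δ_min) for the OPTIMAL curve at q ∥ N (fact takahashi2001_thm_2_3_of_coprime, no _holds); as typed it also needs isogeny transport optimal ↦ E_(a,b) (Mazur–Kenku ≤ 163) and an Eichler setup (N/q, q).
sources: doi:10.1006/jnth.2000.2614, arXiv:1705.09251, PastenShimura2024, doi:10.1073/pnas.94.21.11110, Kenku1982, Literature.NumberTheory.EllipticCurves.takahashi2001_thm_2_3_of_coprime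
[support] The definite Ribet–Takahashi / Pollack–Weston comparison WITH the Eisenstein correction
controlled, in the PRIME form the glue consumes (restated 2026-08-15 from the ∀-admissible-N⁻ form
DefiniteRTControl, stmt-ABC-2022, to its special case N⁻ = q an odd prime — the weakest form that
suffices for DefiniteGlue and the form backed by the vendored fact takahashi2001_thm_2_3): for
coprime a,b, N = conductor, every odd prime q ∣ N and every MINIMAL-degree parametrisation D of
E_(a,b): deg D ≤ C_ε N^ε · ξ(E; N/q, q) · v_q(Δ_min(E)), ξ = brandtXi (N/q) q (a_n(E)). KNOWN in
print (grounders g1/g2/g17-26, page level): Takahashi 2001 (JNT 90) Thm 2.3 p.79 'δ = (h_r/i_r)·j_r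
for any prime r ∣ N' (Grothendieck monodromy pairing + optimality; untouched by the Thm 2.4 gap
flagged by Pasten p.24 / Hamidi arXiv:2607.23244), Thm 3.8 p.84 h_r = ξ(N/r; r) (X_r(J₀) ≅ Div⁰ of
the class set of the Eichler order, Buzzard 1997 Thm 4.7), i_r ∣ κ bounded (Mazur), so deg_min ≤
163·ξ·v_q for squarefree N (tree: takahashi2001_thm_2_3 and its proved corollary
modularDegree_le_brandtXi_mul, TakahashiDegreeFormula.lean, p49978); the non-squarefree case 4 ∣ N
(Frey curves with 16 ∤ abc are not semistable -/
@[route_item "route-ABC-DefiniteXi", crux]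
def DefiniteRTControlPrime : Prop :=
  ∀ ε : ℝ, 0 < ε → ∃ C : ℝ, ∀ a b : ℤ, IsCoprime a b → a * b * (a + b) ≠ 0 → ∀ (N : ℕ) [NeZero N], (Literature.NumberTheory.EllipticCurves.freyCurve a b).conductorNorm ℤ = N → ∀ q : ℕ, q.Prime → q ≠ 2 → q ∣ N → ∀ D : Literature.NumberTheory.EllipticCurves.ModularForms.ModularParametrizationData (Literature.NumberTheory.EllipticCurves.freyCurve a b) N, (∀ D' : Literature.NumberTheory.EllipticCurves.ModularForms.ModularParametrizationData (Literature.NumberTheory.EllipticCurves.freyCurve a b) N, D.deg ≤ D'.deg) → (D.deg : ℝ) ≤ C * (N : ℝ) ^ ε * ((Literature.NumberTheory.Automorphic.brandtXi (N / q) q (fun n => (Literature.NumberTheory.EllipticCurves.freyCurve a b).LFunction n) : ℝ) * (((Literature.NumberTheory.EllipticCurves.freyCurve a b).minimalDiscriminantNorm ℤ).factorization q : ℕ))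

-- earlier XiStrongBound (stmt-ABC-2023, replaced 2026-08-15T17:08:17Z -> stmt-ABC-11337): retired by None — ∀ ε : ℝ, 0 < ε → ∃ C : ℝ, ∀ a b : ℤ, IsCoprime a b → a * b * (a + b) ≠ 0 → ∀ N : ℕ, (Literature.NumberTheory.EllipticCurves.freyCurve a b).conductorNorm ℤ = N → ∀ Nm : ℕ, Odd Nm → Squarefree Nm → Odd Nm.primeFactors.card → Nm ∣ N → (Literature.NumberTheory.Automorphic.brandtXi (N / Nm) Nm (fun
/-- item stmt-ABC-11337 · crux · rank 4 · open · by planner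
why it might fail: Implies X by KNOWN facts (Takahashi 2001 Thm 2.3/3.8 + Pasten Thm 6.1), so it is false if abc fails on Frey curves; exponent 2 sharp (Masser 1990). Risk beyond abc: if N/Nm has no odd prime, abc ⟹ this is unproved (den γ ≤ κ^ω·D only, Pasten 6.1(a); cokernels j_p > 1 occur, Hamidi 2026 Thm C).
sources: Masser1990, doi:10.1006/jnth.2000.2614, arXiv:1705.09251, PastenShimura2024, arXiv:2607.23244, doi:10.1112/s0010437x11005318
[crux] K2 of the card (strong rung): for every ε > 0, C = C(ε): ξ(E;N⁺,N⁻) · ∏_(q|N⁻)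
v_q(Δ_min(E_(a,b))) ≤ C N^(2+ε) for all coprime a,b and admissible N⁻ (notation of XiBound; the
product is the level-lowering part of η_f(N), polynomial unconditionally: ≤ N^(8/3+ε) on Frey curves
by Pasten's Thm 16.8 = tree fact pasten2024_thm_2_5, ≤ N^(1/3+ε) for N⁻ prime by Stewart–Yu). With
DefiniteRTControlPrime, via the PROVED glue DefiniteGlue (N⁻ := one odd prime q ∣ N; the six coprime
pairs with ab(a+b) = ±2^k are absorbed in C): ⟹ the degree bound for minimal data ⟹ (FreyModularity
+ MinimalBoundGivesTarget) FreyDegreeBound ⟹ ABC; conversely abc ⟹ h_F ≤ (½+ε)log N ⟹ deg ≤ N^(2+ε)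
⟹ this (ξ∏v_q ≤ η·γ⁻¹). So, given the known comparison, ABC on Frey curves ⟺ XiStrongBound (outside
the corner N/N⁻ = 2^k named in 'why it might fail'). What makes it attackable here and not on X₀(N):
ξ counts ONLY congruences with forms new at every q | N⁻ (Steinberg deformation condition), an
integer quadratic-form value on a finite class set; no q-expansion, no Petersson norm. TYPED over
the landed brandtXi (restated 2026-08-15 with the uniform binder ∀ (N : ℕ) [NeZero N]). -/
@[route_item "route-ABC-DefiniteXi", crux]
def XiStrongBound : Prop :=
  ∀ ε : ℝ, 0 < ε → ∃ C : ℝ, ∀ a b : ℤ, IsCoprime a b → a * b * (a + b) ≠ 0 → ∀ (N : ℕ) [NeZero N], (Literature.NumberTheory.EllipticCurves.freyCurve a b).conductorNorm ℤ = N → ∀ Nm : ℕ, Odd Nm → Squarefree Nm → Odd Nm.primeFactors.card → Nm ∣ N → (Literature.NumberTheory.Automorphic.brandtXi (N / Nm) Nm (fun n => (Literature.NumberTheory.EllipticCurves.freyCurve a b).LFunction n) : ℝ) * ∏ q ∈ Nm.primeFactors, ((((Literature.NumberTheory.EllipticCurves.freyCurve a b).minimalDiscriminantNorm ℤ).factorization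 q : ℕ) : ℝ) ≤ C * (N : ℝ) ^ (2 + ε)

/-- item stmt-ABC-15023 · crux · rank 5 · open · by planner
why it might fail: Hadamard regime (many unramified even cusp forms ≡ f_E mod 2 at once) or deep wild 2-adic Eisenstein towers at composite level; census residual drifts 0.35–0.5 bit/doubling for curves bad at 2 (N ≤ 2^14); corner N⁺ = 2^k: 2-power denominators of the Eisenstein unit γ (Pasten 6.1(a)).
sources: CalegariEmerton2005, Yoo2015, Ohta2014, WakeWangErickson2020, Katz1980, Mazur1977
[crux] EISENSTEIN QUARANTINE (abc-free; the route's own crux, disjoint from RTSplit's ξ-half). For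
coprime a,b (ab(a+b) ≠ 0), N = conductor of E_(a,b), every admissible N⁻ = Nm (odd, squarefree, ω
odd, Nm ∣ N) and ξ = brandtXi (N/Nm) Nm (a_n(E)): the {2,3}-PART of ξ, sixPart ξ := 2^{v₂ξ}·3^{v₃ξ}
(= ordProj[2] ξ · ordProj[3] ξ), is ≤ C_ε·N^ε·𝓛, where 𝓛 := ∏_{q ∣ N, q ∤ Nm} v_q(Δ_min) is the
level-lowering content of the NON-quarantined bad primes (q = 2 included; 𝓛 = 1 at full quarantine).
Mechanism: in the N⁻-new Brandt module the q-old congruences (order v_q(Δ)·unit, Ribet–Takahashi)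
are absent for q ∣ N⁻ BY CONSTRUCTION and paid for by 𝓛 for q ∣ N⁺; the Eisenstein primes of a Frey
curve are ⊆ {2,3} (E[2] ⊆ E(ℚ) + Mazur–Kenku: ρ̄_{E,ℓ} irreducible for ℓ ≥ 5); the congruence of φ_E
with the Eisenstein vector is 2-adically bounded (a_p ≡ p+1 mod 2^k ∀p ⟹ 2^k ∣ #E'(ℚ)_tors for an
isogenous E', Katz1980 + Mazur ⟹ k ≤ 4); so sixPart ξ is the length of the congruence module of f_E
inside the 2-(3-)adic Eisenstein component of the Hecke algebra of N⁻-new forms of level 2^k·N_odd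
with f_E's Atkin–Lehner signs — an INDEX statement with closed index formulas (Mazur1977; Ohta2014;
Yoo2015) a -/
@[route_item "route-ABC-DefiniteXi", crux]
def EisensteinQuarantine : Prop :=
  ∀ ε : ℝ, 0 < ε → ∃ C : ℝ, ∀ a b : ℤ, IsCoprime a b → a * b * (a + b) ≠ 0 → ∀ (N : ℕ) [NeZero N], (Literature.NumberTheory.EllipticCurves.freyCurve a b).conductorNorm ℤ = N → ∀ Nm : ℕ, Odd Nm → Squarefree Nm → Odd Nm.primeFactors.card → Nm ∣ N → ((ordProj[2] (Literature.NumberTheory.Automorphic.brandtXi (N / Nm) Nm (fun n => (Literature.NumberTheory.EllipticCurves.freyCurve a b).LFunction n)) * ordProj[3] (Literature.NumberTheory.Automorphic.brandtXi (N / Nm) Nm (fun n => (Literature.NumberTheory.EllipticCurves.freyCurve a b).LFunction n)) : ℕ) : ℝ) ≤ C * (N : ℝ) ^ ε * ((∏ q ∈ N.primeFactors \ Nm.primeFactors, ((Literature.NumberTheory.EllipticCurves.freyCurve a b).minimalDiscriminantNorm ℤ).factorization q : ℕ) : ℝ)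

/-- item stmt-ABC-15024 · crux · rank 6 · open · by planner
why it might fail: abc-strength: false iff a Frey family has coprimeSixPart(deg_min)·∏_{q|N} v_q(Δ_min) ≥ N^{2+δ} (e.g. limsup abc-quality > 1); exponent 2 sharp (Masser1990). Beyond abc only if ∏_{q|N} v_q(Δ_min) fails to be N^{o(1)} on Szpiro-extremal families (it is, by Σ v_q log q ≤ (6+ε) log N).
sources: Diamond1997, arXiv:2108.09729, Masser1990, Takahashi2001, Kenku1982, PollackWeston2011
[crux] STEINBERG CORE (abc-strength residual of the line; the complement of EisensteinQuarantine).
Same data (coprime a,b, N, admissible N⁻ = Nm, ξ = brandtXi (N/Nm) Nm (a_n(E))): the PRIME-TO-6 part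
of ξ, coprimeSixPart ξ := ξ / (2^{v₂ξ}·3^{v₃ξ}), times the FULL exponent product ∏_{q ∣ N}
v_q(Δ_min(E_(a,b))) is ≤ C_ε N^{2+ε}. Why this shape: (i) EisensteinQuarantine ∧ SteinbergCore ⟹
XiStrongBound verbatim (pure algebra, inlined in `closes`), so the pair replaces the abc-EQUIVALENT
crux XiStrongBound by two statements NEITHER of which is abc-equivalent: abc ⟹ SteinbergCore (deg φ
≤ N^{2+ε} via Pasten Thm 1.3 / Murty, and ∏ v_q = N^{o(1)} under Szpiro since Σ v_q log q ≤ (6+ε)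
log N) while SteinbergCore alone says nothing about the 6-part, and abc ⇏ EisensteinQuarantine; (ii)
it is IMMUNE to the Eisenstein-unit corner that threatens XiStrongBound at composite N⁻ (γ =
deg/(ξ∏c_q) is a {2,3}-unit on Frey curves — RibetTakahashi1997, PollackWeston2011 Thm 6.8, Pasten
Thm 6.1 — so it never touches the prime-to-6 part: coprimeSixPart(ξ)·∏_{q∣N⁻} v_q =
coprimeSixPart(deg_min)·sixPart(∏_{q∣N⁻} v_q) exactly); (iii) it is PURE: for ℓ ≥ 5 every Frey curve
has ρ̄_{E,ℓ} irreducible (full 2-tor -/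
@[route_item "route-ABC-DefiniteXi", crux]
def SteinbergCore : Prop :=
  ∀ ε : ℝ, 0 < ε → ∃ C : ℝ, ∀ a b : ℤ, IsCoprime a b → a * b * (a + b) ≠ 0 → ∀ (N : ℕ) [NeZero N], (Literature.NumberTheory.EllipticCurves.freyCurve a b).conductorNorm ℤ = N → ∀ Nm : ℕ, Odd Nm → Squarefree Nm → Odd Nm.primeFactors.card → Nm ∣ N → ((Literature.NumberTheory.Automorphic.brandtXi (N / Nm) Nm (fun n => (Literature.NumberTheory.EllipticCurves.freyCurve a b).LFunction n) / (ordProj[2] (Literature.NumberTheory.Automorphic.brandtXi (N / Nm) Nm (fun n => (Literature.NumberTheory.EllipticCurves.freyCurve a b).LFunction n)) * ordProj[3] (Literature.NumberTheory.Automorphic.brandtXi (N / Nm) Nm (fun n => (Literature.NumberTheory.EllipticCurves.freyCurve a b).LFunction n))) : ℕ) : ℝ) * ((∏ q ∈ N.primeFactors, ((Literature.NumberTheory.EllipticCurves.freyCurve a b).minimalDiscriminantNorm ℤ).factorization q : ℕ) : ℝ) ≤ C * (N : ℝ) ^ (2 + ε)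

/-- item stmt-ABC-17203 · crux · rank 8 · closed · proved by Summit.ABC.ABC.Theorems.brandtEigenLatticeRankOne_holds (prover) · by planner
why it might fail: TRUE in print (Eichler basis problem = Pizer1980 Thm 2.28 via trace identity (2.8); JL + mult. one). As typed: level pinned (IsEichlerOrder index M), a_p from the datum, Eisenstein vector excluded (Hasse), setups exist — no junk escape found. Risk = size: two trace formulas, no proof assistant; XL.
sources: Takahashi2001, Pizer1980, Eichler1973, JacquetLanglands1970, Hijikata1974, PollackWeston2011
[crux] PROMOTED PRINTED INPUT (route-choice repair b6fe27e7, 2026-08-17): MULTIPLICITY ONE ON THE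
DEFINITE QUATERNION SIDE — verbatim the body of the XL named fact
Literature.NumberTheory.EllipticCurves.takahashi2001_brandtEigenLattice_rank_one (fully qualified;
Iff.rfl the fact, planner SketchRewire.lean rc 0; inlined so that no unproved named-fact constant
enters the cone). For W/ℚ elliptic of squarefree conductor M·r, r prime, carrying a modular
parametrisation datum at level M·r (so a_p(W) = a_p(f) for its newform f, new at r), and every
Brandt setup S of type (M, r) (definite quaternion algebra of discriminant r, Eichler order O of
level M): the common eigen-lattice {v ∈ ℤ^{Cls O} : T(p) v = a_p(W) v for all primes p ∤ Mr} of the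
Brandt matrices has ℤ-rank ONE. In print: Takahashi 2001 §2 p.78 ('L_r(J) is a free ℤ-module of rank
one', asserted); = Eichler's basis problem, Pizer 1980 Thm 2.28 ((ℂ^{Cls O})⁰ ⊕ 2·S₂(Γ₀(M)) ≅
S₂(Γ₀(Mr)) as Hecke modules away from Mr) + Atkin–Lehner strong multiplicity one; equivalently
Jacquet–Langlands with multiplicity one for D^×. WHY A CRUX OF THIS ROUTE: it is the eigen-LINE
behind ξ = brandtXi = Σ w_i φ_i² (ξ is the junk value 0 off rank one) -/
@[route_item "route-ABC-DefiniteXi", crux]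
def BrandtEigenLatticeRankOne : Prop :=
  ∀ (W : WeierstrassCurve ℚ) [W.IsElliptic] (M r : ℕ) [NeZero (M * r)], r.Prime → Squarefree (M * r) → W.conductorNorm ℤ = M * r → ∀ (_P : Literature.NumberTheory.EllipticCurves.ModularForms.ModularParametrizationData W (M * r)) (S : Literature.NumberTheory.Automorphic.Brandt.XiSetup M r) [Fintype (Literature.NumberTheory.Automorphic.Brandt.ClassSet S.O)], Module.finrank ℤ (Literature.NumberTheory.Automorphic.Brandt.eigenLattice (M * r) (Literature.NumberTheory.Automorphic.Brandt.matrix S.O) (fun n => W.LFunction n)) = 1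

-- `BrandtEigenLatticeRankOne` holds: proved by `Summit.ABC.ABC.Theorems.brandtEigenLatticeRankOne_holds` (its module imports this route file, so no `_holds` link can be stated here).

/-- item stmt-ABC-11340 · crux · rank 9 · open · by planner
why it might fail: TRUE in print (Diamond–Kramer 1995 for exactly y²=x(x−a)(x+b); CDT 1999 Thm 7.1.2 since 27∤N; BCDT Thm A): cannot fail mathematically. Risk is formal only: residual = Modularity (2) for Frey curves (landed iff) = R=T at 3/5 + Langlands–Tunnell + 3–5 switch; XL, in no proof assistant.
sources: doi:10.4310/mrl.1995.v2.n3.a6, ConradDiamondTaylor1999, BCDTJAMS2001, Diamond1996, Wiles1995, TaylorWiles1995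
[support] Modularity of Frey curves in DATUM form — the EXISTENCE half of X, isolated as its own
item so that the deciding theorem `closes` is unconditional and the route's dependency cone carries
no unproved Literature fact: every Frey curve E_(a,b) = freyCurve a b (a, b coprime, ab(a+b) ≠ 0)
carries a ModularParametrizationData at its conductor level N (verbatim the first antecedent of
MinimalBoundGivesTarget). TRUE (Wiles 1995 / Breuil–Conrad–Diamond–Taylor 2001 Thm A; level =
conductor by Carayol 1986) but XL to formalise: it is the tree's named fact
`Literature.NumberTheory.EllipticCurves.ModularForms.nonempty_modularParametrizationData`
transported to the (non-minimal) Frey model. The transport fact → this item is routine and was the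
former item FreyParametrizationExists (stmt-ABC-3327, dropped from the route in this repair because
its statement NAMES the unproved fact and thereby made the whole route unstaffable under the
2026-08-15 cone rule): globally minimal model W' = E.variableChange C
(hasGlobalMinimalModel_rat_holds), conductorNorm model-invariant (conductorNorm_smul_rat),
lattice/newform/Manin-constant transport (LFunction_smul, IsNeronLatticeOf.smul). needs-fact: no -/
@[route_item "route-ABC-DefiniteXi", crux]
def FreyModularity : Prop :=
  ∀ a b : ℤ, IsCoprime a b → a * b * (a + b) ≠ 0 → ∀ (N : ℕ) [NeZero N], (Literature.NumberTheory.EllipticCurves.freyCurve a b).conductorNorm ℤ = N → Nonempty (Literature.NumberTheory.EllipticCurves.ModularForms.ModularParametrizationData (Literature.NumberTheory.EllipticCurves.freyCurve a b) N)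

-- earlier XiBound (stmt-ABC-2021, replaced 2026-08-15T17:08:17Z -> stmt-ABC-11336): retired by None — ∃ A C : ℝ, ∀ a b : ℤ, IsCoprime a b → a * b * (a + b) ≠ 0 → ∀ N : ℕ, (Literature.NumberTheory.EllipticCurves.freyCurve a b).conductorNorm ℤ = N → ∀ Nm : ℕ, Odd Nm → Squarefree Nm → Odd Nm.primeFactors.card → Nm ∣ N → (Literature.NumberTheory.Automorphic.brandtXi (N / Nm) Nm (fun n => (Literature.Num
/-- item stmt-ABC-11336 · aside · rank 2 · open · by planner
why it might fail: Unconditionally ⟺ polynomial Szpiro on Frey curves: ξ = h_r, δ_(D,M) = h_r·j_r/i_r (Takahashi 2001 Thm 3.8, 2.3), i_r | κ_S, γ within 163^ω…κ^ω·D (Pasten L.6.14, Thm 6.1): polynomial losses only. Wide open (best: log|Δ| ≪ rad^(1/3)(log rad)³, Stewart–Yu); false iff an abc family has log c/log rad→∞.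
sources: doi:10.1006/jnth.2000.2614, arXiv:1705.09251, PastenShimura2024, doi:10.1112/s0010437x11005318, doi:10.1090/s0894-0347-02-00390-9, StewartTijdeman1986
[crux] K1 of the card (weak rung). For coprime a,b (ab(a+b) ≠ 0), N = conductor of E_(a,b), and
every admissible N⁻ = Nm (odd, squarefree, odd number of prime factors, Nm | N; N⁺ = N/Nm):
ξ(E;N⁺,N⁻) ≤ C·N^A for absolute A, C. Here ξ = brandtXi N⁺ N⁻ (n ↦ a_n(E)) := Σ_i w_i φ_i², φ a
primitive generator of the ℤ-line {v ∈ ℤ[Cl(O_(N⁺,N⁻))] : T_p v = a_p(E) v for p ∤ N} in the Brandt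
module of the Eichler order of level N⁺ in the definite quaternion algebra of discriminant N⁻ (rank
1 by Jacquet–Langlands + multiplicity one), w_i = |O_i^×|/2 (Gross 1987 §§3–4; Pollack–Weston 2011
§2.1). TYPED over the landed definition brandtXi (Automorphic/BrandtXi.lean; restated 2026-08-15
with the uniform binder ∀ (N : ℕ) [NeZero N] — a conductor is never 0). Given the definite RT
comparison (DefiniteRTControlPrime, polynomial form) it is EQUIVALENT to PolyFreyDegree and to
polynomial Szpiro |Δ| ≤ N^κ on Frey curves (⟸: deg_min ≤ N^B ξ ∏v_q and v_q(Δ) ≤ 2 log₂ c ≤ N^16 by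
Stewart–Tijdeman; ⟹: ξ ≤ η_f(N) ≍ deg φ ≤ N^(2κ+1+ε)). Handles: φ is an integer common eigenvector
of Pizer's Brandt matrices (Ramanujan graphs, ≈ N/12 vertices); ℓ-part of ξ = length of the adjoint
Selmer group of ρ_(E,ℓ) Steinber -/
@[route_item "route-ABC-DefiniteXi", crux]
def XiBound : Prop :=
  ∃ A C : ℝ, ∀ a b : ℤ, IsCoprime a b → a * b * (a + b) ≠ 0 → ∀ (N : ℕ) [NeZero N], (Literature.NumberTheory.EllipticCurves.freyCurve a b).conductorNorm ℤ = N → ∀ Nm : ℕ, Odd Nm → Squarefree Nm → Odd Nm.primeFactors.card → Nm ∣ N → (Literature.NumberTheory.Automorphic.brandtXi (N / Nm) Nm (fun n => (Literature.NumberTheory.EllipticCurves.freyCurve a b).LFunction n) : ℝ) ≤ C * (N : ℝ) ^ A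

/-- item stmt-ABC-15853 · aside · rank 7 · open · by planner
why it might fail: TRUE in print (Kim 2003 Thm B: Sym⁴π_E automorphic on GL₅; cuspidal for non-CM E, Kim–Shahidi 2002; Godement–Jacquet entire; convexity × conductor ≤ N^O(1), Rouse 2007), audited true AS TYPED (cdisprove, line-audit ×2, leads c1–c6). Risk = size: GL(5) functoriality is in no proof assistant; XL.
sources: Kim2003, KimShahidiCusp2002, KimShahidi2002, GodementJacquet1972, IwaniecKowalski2004, Rouse2007
[crux] PROMOTED PRINTED INPUT (route-choice repair e6b77e02, 2026-08-16): the analytic package of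
L(s, Sym⁴ E) for non-CM E/ℚ — verbatim the body of the XL named fact
Literature.NumberTheory.Automorphic.Kim2003_symmFourL_nonCM_entire_polyBound (fully qualified;
Iff.rfl the fact, planner Sketch.lean rc 0; inlined so that no unproved named-fact constant enters
the cone). For an elliptic W/ℚ without CM and its newform f ∈ S₂(Γ₀(N)) (IsNewformOf W f), the
good-prime symmetric fourth power Euler product L^(N)(s, Sym⁴ E) = exp(Σ_{p∤N} Σ_{k≥1} T₄(C_k(Re
a_p(f)/√p)) k⁻¹ p^{−ks}), T₄(x) = x⁴ − 3x² + 1, converges absolutely on Re s > 1 and is the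
restriction of an ENTIRE function L₄ bounded by C·N^K on the disc |s − 2| ≤ 3/2, with absolute C ≥
1, K ≥ 0. In print: Sym⁴π_E is automorphic on GL₅(𝔸_ℚ) (Kim2003 Thm B), cuspidal off the
dihedral/tetrahedral/octahedral types (KimShahidiCusp2002 Thm 3.3.7, Prop 3.3.8; a non-CM weight-2
newform is of none of these, KimShahidi2002 §6), its standard L-function is entire with functional
equation (GodementJacquet1972 Thm 13.8), whence convexity in the conductor aspect
(IwaniecKowalski2004 §5.2) with conductor ≤ N^O(1) (Rouse2007 L 2.1). WHY A CRUX OF THI -/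
@[route_item "route-ABC-DefiniteXi"]
def SymmFourAnalyticPackage : Prop :=
  ∃ C K : ℝ, 1 ≤ C ∧ 0 ≤ K ∧ ∀ (N : ℕ) [NeZero N] (W : WeierstrassCurve ℚ) [W.IsElliptic] (f : CuspForm (CongruenceSubgroup.Gamma0 N) 2), Literature.NumberTheory.EllipticCurves.ModularForms.IsNewformOf W f → ¬ W.HasCM → ∃ L₄ : ℂ → ℂ, Differentiable ℂ L₄ ∧ (∀ s : ℂ, 1 < s.re → (∀ p : Nat.Primes, Summable fun k : ℕ ↦ ‖((if ¬ (p : ℕ) ∣ N then (((Polynomial.Chebyshev.C ℝ (k + 1)).eval ((Literature.NumberTheory.EllipticCurves.ModularForms.cuspCoeff f p).re / Real.sqrt p)) ^ 4 - 3 * ((Polynomial.Chebyshev.C ℝ (k + 1)).eval ((Literature.NumberTheory.EllipticCurves.ModularForms.cuspCoeff f p).re / Real.sqrt p)) ^ 2 + 1) / (k + 1) else 0 : ℝ) : ℂ) * (p : ℂ) ^ (-((k + 1 : ℕ) : ℂ) * s)‖) ∧ (Summable fun p : Nat.Primes ↦ ∑' k : ℕ, ‖((if ¬ (p : ℕ)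 ∣ N then (((Polynomial.Chebyshev.C ℝ (k + 1)).eval ((Literature.NumberTheory.EllipticCurves.ModularForms.cuspCoeff f p).re / Real.sqrt p)) ^ 4 - 3 * ((Polynomial.Chebyshev.C ℝ (k + 1)).eval ((Literature.NumberTheory.EllipticCurves.ModularForms.cuspCoeff f p).re / Real.sqrt p)) ^ 2 + 1) / (k + 1) else 0 : ℝ) : ℂ) * (p : ℂ) ^ (-((k + 1 : ℕ) : ℂ) * s)‖) ∧ L₄ s = Complex.exp (∑' p : Nat.Primes, ∑' k : ℕ, ((if ¬ (p : ℕ) ∣ N then (((Polynomial.Chebyshev.C ℝ (k + 1)).eval ((Literature.NumberTheory.EllipticCurves.ModularForms.cuspCoeff f p).re / Real.sqrt p)) ^ 4 - 3 * ((Polynomial.Chebyshev.C ℝ (k + 1)).eval ((Literature.NumberTheory.EllipticCurves.ModularForms.cuspCoeff f p).re / Real.sqrt p)) ^ 2 + 1) / (k + 1) else 0 : ℝ) : ℂ) * (p : ℂ) ^ (-((k + 1 : ℕ) : ℂ) * s))) ∧ ∀ s ∈ Metric.closedBall (2 : ℂ) (3 / 2), ‖L₄ s‖ ≤ C * (N :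 ℝ) ^ K

/-- item stmt-ABC-10870 · support · rank 9 · open · by planner
why it might fail: KNOWN (Hoffstein–Lockhart 1994 + GHL: L(1,Sym² f) ≫ 1/log N, f non-dihedral; CM f: 13 class-number-one fields; (f,f) ≍ N·L(1,Sym² f)·N^(o(1)) at p² | N) but L/XL formal debt (Rankin–Selberg on Γ₀(N), zero-free region). As typed it needs IsNewformOf to pin a₁ = 1 (it does; else false by scaling f).
sources: HoffsteinLockhart1994, MurtyCongruencePrimes1999, arXiv:1705.09251, PastenShimura2024, Literature.NumberTheory.EllipticCurves.ModularForms.murty_petersson_newform_lower_bound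
[support] NAMED FACT as item — verbatim the body of
Literature.NumberTheory.EllipticCurves.ModularForms.murty_petersson_newform_lower_bound
(NewformPeterssonSize.lean), closable by 'exact murty_petersson_newform_lower_bound_holds' the day
the fact is discharged: for every ε > 0 there is c > 0 with c·N^(1−ε) ≤ Re (f,f)_{Γ₀(N)} for every N
≥ 1, every elliptic W/ℚ and every f ∈ S₂(Γ₀(N)) with IsNewformOf W f (then N = N_W); (·,·) = the
tree's un-normalised peterssonProduct. In print: 2 log ‖f‖ ∼ log N (MurtyCongruencePrimes1999),
lower bound via Rankin–Selberg (f,f) ≍ N^(1+o(1)) L(1, Sym² f) and L(1, Sym² f) ≫_ε N^(−ε)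
(HoffsteinLockhart1994 with the Goldfeld–Hoffstein–Lieman appendix; Siegel for CM f). The ONE
undischarged input of the frame X → ABC of this route (Literature abcLe_of_semistableDegreeBound +
abcLt_of_abcLe; Silverman's inequality is PROVED, silverman1986_discriminant_c4_covolume_holds);
f-form, stronger than the D-forms RibetTakahashiSplit.PeterssonLowerBound (stmt-ABC-1565) /
QuaternionicDegree.PeterssonLowerBound (stmt-ABC-1720), which it implies with f := D.f. Not expected
to be proved in Lean soon. Sources: HoffsteinLockhart1994, MurtyCongruencePrimes1999, PastenS -/
@[route_item "route-ABC-DefiniteXi", crux]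
def PeterssonLowerBound : Prop :=
  ∀ ε : ℝ, 0 < ε → ∃ c : ℝ, 0 < c ∧ ∀ (N : ℕ) [NeZero N] (W : WeierstrassCurve ℚ) [W.IsElliptic] (f : CuspForm (CongruenceSubgroup.Gamma0 N) 2), Literature.NumberTheory.EllipticCurves.ModularForms.IsNewformOf W f → c * (N : ℝ) ^ (1 - ε) ≤ (Literature.NumberTheory.EllipticCurves.ModularForms.peterssonProduct (CongruenceSubgroup.Gamma0 N) 2 f f).re

/-- item stmt-ABC-11341 · support · rank 9 · closed · proved by Summit.ABC.ABC.Theorems.TwoAdicEisensteinAnchor.definiteGlue_holds (prover) · by planner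
[support] The glue of the line — PROVED sorry-free in the repair planner's sketch
GlueProofSketch2.lean (rc 0, axioms propext/choice/Quot.sound; attached as evidence; a prover
re-files it as Theorems/DefiniteGlue.lean against the route decls): XiStrongBound →
DefiniteRTControlPrime → (for every ε > 0 there is C such that every MINIMAL-degree datum D of
E_(a,b) at level N = conductor has deg D ≤ C·N^(2+ε)) — the conclusion is verbatim the second
antecedent of MinimalBoundGivesTarget, so `closes` chains it. Proof plan: fix ε; take C₁ from
XiStrongBound at ε/2 and C₂ from DefiniteRTControlPrime at ε/2, replace both by max(·,0)
(legitimate: the Brandt side ξ·∏v_q is a cast natural number, ≥ 0). For (a,b,N,D minimal): if some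
ODD prime q ∣ N, use Nm := q (Odd q, Squarefree q, q.primeFactors = {q} of odd cardinality 1, q ∣
N): deg D ≤ C₂ N^(ε/2)·ξ(N/q,q)·v_q(Δ_min) ≤ C₂C₁ N^(2+ε) (Real.rpow_add, N ≥ 1 from NeZero). If NO
odd prime divides N: rad|ab(a+b)| ∣ 2N (tree:
Literature.NumberTheory.EllipticCurves.radical_natAbs_dvd_two_mul_conductorNorm_freyCurve,
DegreeConjectureAbcMurtyProofs.lean:550) makes |a|, |b|, |a+b| powers of 2, and coprimality leaves
exactly the six pairs (1,1), (−1,−1 -/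
@[route_item "route-ABC-DefiniteXi", crux]
def DefiniteGlue : Prop :=
  XiStrongBound → DefiniteRTControlPrime → ∀ ε : ℝ, 0 < ε → ∃ C : ℝ, ∀ a b : ℤ, IsCoprime a b → a * b * (a + b) ≠ 0 → ∀ (N : ℕ) [NeZero N], (Literature.NumberTheory.EllipticCurves.freyCurve a b).conductorNorm ℤ = N → ∀ D : Literature.NumberTheory.EllipticCurves.ModularForms.ModularParametrizationData (Literature.NumberTheory.EllipticCurves.freyCurve a b) N, (∀ D' : Literature.NumberTheory.EllipticCurves.ModularForms.ModularParametrizationData (Literature.NumberTheory.EllipticCurves.freyCurve a b) N, D.deg ≤ D'.deg) → (D.deg : ℝ) ≤ C * (N : ℝ) ^ (2 + ε)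

-- `DefiniteGlue` holds: proved by `Summit.ABC.ABC.Theorems.TwoAdicEisensteinAnchor.definiteGlue_holds` (its module imports this route file, so no `_holds` link can be stated here).

/-- item stmt-ABC-11342 · support · rank 9 · closed · proved by Summit.ABC.ABC.Theorems.degreeBoundToABCOfPetersson_proof (prover) · by planner
[support] The frame X → ABC made PROVABLE NOW: PeterssonLowerBound → FreyDegreeBound → ABC. One line
from the tree (checked rc 0 in the repair planner's SketchProofs.lean): `fun hP hdeg =>
Literature.NumberTheory.EllipticCurves.abcLt_of_freyDegreeBound hP
Literature.NumberTheory.EllipticCurves.ModularForms.silverman1986_discriminant_c4_covolume_holds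
hdeg` (DegreeConjectureAbc.lean:295, whose conclusion is literally the body of `ABC`; Silverman's
covolume inequality is PROVED in SilvermanHeightCovolumeProofs.lean:452; PeterssonLowerBound =
stmt-ABC-10870, shared with route IsogenyGlueCongruence, is definitionally the Petersson fact).
Mathematics (Frey 1989; Mai–Murty 1994; Murty 1999 Thm 1, direction degree conjecture ⟹ abc; Pasten
§3 Rem 3.3): Zagier 4π²c²(f,f) = deg·covol(Λ), c ∈ ℤ∖{0} so c² ≥ 1 only helps, (f,f) ≫ N^(1−ε) ⟹
covol ≫ N^(−1−2ε) ⟹ Silverman ⟹ |c₄|³ ≪ N^((1+2ε)(6+ε)) ⟹ c ≪ rad^(1+ε'). Supersedes the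
unconditional DegreeBoundToABC (stmt-ABC-2025: unprovable in tree without the Petersson fact;
dropped in the follow-up edit of this repair) as the frame item; the legacy Assembly is restated to
mirror `closes`. Sources: doi:10.1090/pspum/066.1/1703750, doi:10.1007/bfb0086 -/
@[route_item "route-ABC-DefiniteXi", crux]
def DegreeBoundToABCOfPetersson : Prop :=
  PeterssonLowerBound → FreyDegreeBound → _root_.ABC

-- `DegreeBoundToABCOfPetersson` holds: proved by `Summit.ABC.ABC.Theorems.degreeBoundToABCOfPetersson_proof` (its module imports this route file, so no `_holds` link can be stated here).

/-- item stmt-ABC-14722 · support · rank 9 · open · by planner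
[support] LADDER GLUE wiring the weak rung into the deciding theorem (route-repair 2026-08-16, gate
check glue.unused-crux): XiBound → XiStrongBound. Role: structural — it records, inside the cone of
`closes` (which consumes XiStrongBound), that the staffed rank-2 crux XiBound (ξ(E;N/N⁻,N⁻) ≤ C·N^A;
live crux chain: 4 landed Negative modules, 3 skeleton lines, lead prover on two-adic-redei-depth)
is the FIRST RUNG of the rank-4 crux XiStrongBound (ξ·∏_(q|N⁻) v_q(Δ_min) ≤ C_ε N^(2+ε)), so that
`closes` is reached either directly from XiStrongBound or as XiBound + this item. Provability,
stated honestly: (i) IMMEDIATE from XiStrongBound (`fun h _ => h`) — it closes the moment the r4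
crux does; (ii) GIVEN only XiBound it is the residual upgrade 'polynomial exponent A ↦ 2+ε, together
with the level-lowering factor ∏ v_q(Δ_min) (itself ≤ N^(8/3+ε) by the tree fact pasten2024_thm_2_5,
≤ N^(1/3+ε) for N⁻ prime by Stewart–Yu)', which is abc-strength on Frey curves (XiStrongBound ∧
DefiniteRTControlPrime ⟹ X ⟹ ABC through the proved DefiniteGlue) and for which no bootstrapping
from a polynomial to the sharp exponent is known (no tensor-power / base-change amplification on
Frey triples over -/
@[route_item "route-ABC-DefiniteXi", crux]
def XiBoundUpgrade : Prop :=
  XiBound → XiStrongBound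

/-- item stmt-ABC-15125 · aside · rank 9 · open · by planner
why it might fail: KNOWN (Mazur1978 Thm 1 + Kenku1982; Edixhoven input PROVED, stmt-ABC-15990): cannot fail in print. Residual = MazurKenkuRadius (stmt-ABC-15193) via landed mazurKenkuBound_of_radiusItem; live line radius-lite (7 stubs, 3 landed; hardest stub_cor44 = Mazur Cor 4.4, XL). Risk formal only.
sources: Mazur1978, Kenku1982, PastenShimura2024, arXiv:1705.09251, SilvermanAEC2009, EdixhovenManin1991
[crux, rank 9 — KNOWN in print, XL formal debt; route-choice PROMOTION (planner rchoice 1e5e4a86,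
2026-08-16) of the apex Literature fact
Literature.NumberTheory.EllipticCurves.ModularForms.PastenShimura2024_minimalDegree_le_163_mul,
whose body this statement repeats VERBATIM (definitionally equal — Sketch.lean `Iff.rfl`: closable
by `exact PastenShimura2024_minimalDegree_le_163_mul_holds` the day the fact is discharged, and
usable as is wherever a tree theorem takes `(h163 : PastenShimura2024_minimalDegree_le_163_mul)`)]
MazurKenkuBound — the Mazur–Kenku comparison of modular degrees inside an isogeny class: if D is a
parametrisation datum at level N of minimal degree among all data with the same newform (the optimal
parametrisation, deg D = δ_{1,N}) and D' is a datum of a GLOBALLY MINIMAL elliptic W' with the same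
newform, of minimal degree among the data of W' itself, then deg D' ≤ 163·deg D. In print
(PastenShimura2024 §3 p.13): every parametrisation of W' factors through the optimal quotient
followed by an isogeny; ℚ-isogenous curves are joined by a CYCLIC ℚ-isogeny of degree in Kenku's
list {1..19,21,25,27,37,43,67,163} (Mazur1978 Thm 1 for prime degree — Eisenstein ideal —, -/
@[route_item "route-ABC-DefiniteXi", crux]
def MazurKenkuBound : Prop :=
  ∀ (N : ℕ) [NeZero N] (W W' : WeierstrassCurve ℚ) [W.IsElliptic] [W'.IsElliptic] [W'.IsGloballyMinimal] (D : Literature.NumberTheory.EllipticCurves.ModularForms.ModularParametrizationData W N) (D' : Literature.NumberTheory.EllipticCurves.ModularForms.ModularParametrizationData W' N), D'.f = D.f → (∀ (W'' : WeierstrassCurve ℚ) [W''.IsElliptic] (D'' : Literature.NumberTheory.EllipticCurves.ModularForms.ModularParametrizationData W'' N), D''.f = D.f → D.modularDegree ≤ D''.modularDegree) → (∀ D'' : Literature.NumberTheory.EllipticCurves.ModularForms.ModularParametrizationData W' N, D'.modularDegree ≤ D''.modularDegree) → D'.modularDegree ≤ 163 * D.modularDegree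

/-- item stmt-ABC-15193 · aside · rank 9 · open · by planner
why it might fail: KNOWN in print (Mazur1978 Thm 1 + Kenku1982; AEC IX.6 Ex 6.4): cannot fail. Risk formal only, XL: Eisenstein-ideal proof of Mazur Thm 1 + Kenku's X₀(N)(ℚ) determinations, none in Mathlib; shared apex stmt-ABC-15193 (certificate programme under IsogenyGlueCongruence).
sources: Mazur1978, Kenku1982, SilvermanAEC2009, PastenShimura2024, arXiv:1705.09251
[crux] MAZUR–KENKU RADIUS (route-choice cd68f10e, 2026-08-16: PROMOTION of the XL-apex Literature
fact Literature.NumberTheory.Automorphic.ShimuraParametrizationData.minimalDegree_le_163_mul —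
hypothesis 5 of BOTH package theorems of this route, stub_twoPrimePackage_of_facts
(Theorems/RibetTakahashiSplitFewPrimeValuationProductStubTwoPrimePackage; crux r4 stmt-ABC-1563,
line switching-triangle, stub stub_twoPrimePackage) and jlPackage_printedClass_of_facts
(Theorems/RibetTakahashiSplitManyPrimeValuationProductJLPackagePrintedClass; r2 family
stmt-ABC-1561/15149/15174) — in the RADIUS form every consumer actually uses). Statement: two
ℚ-isogenous elliptic curves over ℚ are joined by a ℚ-isogeny of degree ≤ 163 (Mazur 1978 Thm 1 +
Kenku 1982; Silverman AEC IX.6 Ex. 6.4; tree vocabulary WeierstrassCurve.IsIsogenous /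
Isogeny.degree of Literature/NumberTheory/EllipticCurves/Isogeny). WHY THIS FORM. (i) The apex fact
is its PROVED corollary: glue minimalDegree_le_163_mul_of_radius : MazurKenkuRadius →
minimalDegree_le_163_mul (planner Sketch.lean, lean rc 0 — the tree's
deg_le_163_mul_deg_of_isIsogenous uses Mazur–Kenku only through exists_isogeny_degree_le_163), and
so is the packages' -/
@[route_item "route-ABC-DefiniteXi", crux]
def MazurKenkuRadius : Prop :=
  ∀ (W W' : WeierstrassCurve ℚ) [W.IsElliptic] [W'.IsElliptic], W.IsIsogenous W' → ∃ φ : WeierstrassCurve.Isogeny W W', φ.degree ≤ 163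

/-- item stmt-ABC-15911 · support · rank 9 · closed · proved by Summit.ABC.ABC.Theorems.isogenyGlueCongruence_peterssonOfSymmFour_proof @ f1cb494af78b (prover) · by planner
[support] WIRING, PROVABLE NOW in one line (route-choice repair e6b77e02, 2026-08-16): the promoted
crux implies the Petersson item — SymmFourAnalyticPackage → PeterssonLowerBound. Proof: `fun h =>
Summit.ABC.ABC.Theorems.PeterssonLowerBound_of h` (Theorems/DefiniteXiPeterssonLowerBound.lean,
p107692: line Sketch of stmt-ABC-10870 — Goldfeld–Hoffstein–Lieman on the Siegel ball, stubs p98483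
p103615 p103973 p105349) for route DefiniteXi, and `fun h =>
Summit.ABC.ABC.Theorems.IsogenyGlueCongruence_PeterssonLowerBound_of h` (p114534) for route
IsogenyGlueCongruence; both typecheck because SymmFourAnalyticPackage is Iff.rfl the named fact
Kim2003_symmFourL_nonCM_entire_polyBound (planner proof file PeterssonOfSymmFourProof.lean attached
as evidence, rc 0 on the farm — a prover lands it verbatim, e.g.
Theorems/DefiniteXiPeterssonOfSymmFour.lean). Literature twin:
murty_petersson_newform_lower_bound_of_symmFour (NewformPeterssonSizeSymmFourReductionProofs.lean,
PROVED). ROLE: the one extra binder that lets the CRUX-ONLY deciding theorem take hK :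
SymmFourAnalyticPackage (crux) instead of the open support hP : PeterssonLowerBound without
importing Theorems (cyclic) or a heavy Literature p -/
@[route_item "route-ABC-DefiniteXi"]
def PeterssonOfSymmFour : Prop :=
  SymmFourAnalyticPackage → PeterssonLowerBound

-- `PeterssonOfSymmFour` holds: proved by `Summit.ABC.ABC.Theorems.isogenyGlueCongruence_peterssonOfSymmFour_proof` @ f1cb494af78b (its module imports this route file, so no `_holds` link can be stated here).

/-- item stmt-ABC-18928 · aside · rank 9 · open · by planner
why it might fail: KNOWN (PastenShimura2024 L.6.8 ⇐ Mazur1978 Thm 1 + Kenku1982): cannot fail in print. Mazur-deep as typed (⟹ no prime-degree ℚ-isogeny ℓ>163 at a multiplicative prime). Risk formal, XL; residual = MazurKenkuRadius stmt-ABC-15193 (item PROVED from it, evidence rc0).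
sources: PastenShimura2024, arXiv:1705.09251, Mazur1978, Kenku1982, SilvermanAEC2009, Takahashi2001
[crux, rank 9 — KNOWN in print, XL formal debt; route-choice PROMOTION (planner rchoice d59cfa0c,
2026-08-17) of the apex Literature fact
Literature.NumberTheory.EllipticCurves.ModularForms.PastenShimura2024_lemma_6_8, whose body this
statement repeats VERBATIM (definitionally equal — planner Sketch.lean `Iff.rfl`, lean rc 0:
closable by `exact PastenShimura2024_lemma_6_8_holds` the day the fact is discharged, and usable as
is wherever a tree theorem takes `(h68 : PastenShimura2024_lemma_6_8)` —
Theorems/DefiniteXiSteinbergCoreXiDegreeComparisonPrime.lean `xiDegreeComparison_prime_of_facts`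
(p137891, crux r6 SteinbergCore line p6_tamagawa_split, child XiDegreeComparison at prime type),
Theorems/DefiniteXiSteinbergCoreXiDegreeComparison.lean,
Theorems/DefiniteXiDefiniteRTControlPrime.lean `definiteRTControlPrime_of_facts` and its stub
Theorems/DefiniteXiDefiniteRTControlPrimeValTransport.lean `stub_valTransport` (crux r3 line
Sketch))] IsogenyValuationTransport — Pasten 2024 Lemma 6.8, transport of the exponent c_p =
v_p(Δ_min) inside a ℚ-isogeny class: if W, W' are ℚ-isogenous elliptic curves over ℚ and v is a
place of multiplicative reduction of W (hence of W'), then c_v(W)·n = c_ -/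
@[route_item "route-ABC-DefiniteXi", crux]
def IsogenyValuationTransport : Prop :=
  ∀ (W W' : WeierstrassCurve ℚ) [W.IsElliptic] [W'.IsElliptic], W.IsIsogenous W' → ∀ v : IsDedekindDomain.HeightOneSpectrum ℤ, W.HasMultiplicativeReductionAt v → ∃ m n : ℕ, 0 < m ∧ m ≤ 163 ∧ 0 < n ∧ n ≤ 163 ∧ W.ordMinimalDiscriminant v * n = W'.ordMinimalDiscriminant v * m

/-- item stmt-ABC-2026 · support · rank 9 · open · by planner
[support] Typed weak rung: absolute A, C with deg_min φ_(E_(a,b)) ≤ C N^A. OPEN (polynomial Szpiro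
on Frey curves in disguise: ⟹ |Δ_min| ≤ N^(6A+ε) by the argument of DegreeBoundToABC; ⟸ by abc-type
height bounds). In this route it is the GL₂ avatar of XiBound: XiBound ∧ DefiniteRTControl (poly
form: N^B for N^ε) ∧ v_q(Δ) ≤ N^16 (StewartTijdeman1986, tree: stewartTijdeman1986_upperBound) ⟹
PolyFreyDegree. Anyone may attack it directly (Murty–Pasten 2013 give log deg ≪ N log N-type bounds;
nothing polynomial is known). Trivially implied by FreyDegreeBound (Sketch.lean example). -/
@[route_item "route-ABC-DefiniteXi", crux]
def PolyFreyDegree : Prop :=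
  ∃ A C : ℝ, ∀ a b : ℤ, IsCoprime a b → a * b * (a + b) ≠ 0 → ∀ (N : ℕ) [NeZero N], (Literature.NumberTheory.EllipticCurves.freyCurve a b).conductorNorm ℤ = N → ∃ D : Literature.NumberTheory.EllipticCurves.ModularForms.ModularParametrizationData (Literature.NumberTheory.EllipticCurves.freyCurve a b) N, (D.deg : ℝ) ≤ C * (N : ℝ) ^ A

/-- item stmt-ABC-2027 · support · rank 9 · closed · proved by Summit.ABC.ABC.Theorems.polyDegreeToPolyABC_proof (prover) · by planner
[support] The weak rung reaches a polynomial abc inequality c ≤ C·rad(abc)^κ (absolute κ; today only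
log c ≪ rad^(1/3)(log rad)³, Stewart–Yu = tree stewart_yu, is known — cf.
Literature.Barriers.ABC.BakerMethodBounds / BakerShapeBound 0 1). Same proof as DegreeBoundToABC
with exponents carried: deg ≤ C N^A ⟹ h_F ≤ (A/2) log N + O(1) ⟹ max(|Δ|,|c₄|³) ≤ N^(6A+ε) on Frey
curves ⟹ c ≪ rad^κ(A). Records the (★) equivalence of the card on the typed side. -/
@[route_item "route-ABC-DefiniteXi"]
def PolyDegreeToPolyABC : Prop :=
  PolyFreyDegree → ∃ κ C : ℝ, ∀ a b c : ℕ, Literature.NumberTheory.DiophantineGeometry.IsABCTriple a b c → (c : ℝ) ≤ C * ((Literature.NumberTheory.DiophantineGeometry.rad a b c : ℕ) : ℝ) ^ κ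

-- `PolyDegreeToPolyABC` holds: proved by `Summit.ABC.ABC.Theorems.polyDegreeToPolyABC_proof` (its module imports this route file, so no `_holds` link can be stated here).

/-- item stmt-ABC-3328 · support · rank 9 · closed · proved by Summit.ABC.ABC.Theorems.minimalBoundGivesTarget_proof (prover) · by planner
[support] Glue shape of the future split of X (provable NOW; Sketch.lean of the repair planner has a
10-line proof by Nat.find): if every Frey curve carries some parametrisation datum at its conductor
level (the conclusion of FreyParametrizationExists, i.e. modularity) and every MINIMAL-degree datum
D of E_(a,b) at level N = conductor satisfies deg D ≤ C_ε N^(2+ε), then FreyDegreeBound (the ∃-form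
thesis X) holds. It isolates exactly where existence (the named fact
nonempty_modularParametrizationData) enters the line: the definite-side cruxes XiStrongBound ∧
DefiniteRTControl (blocked on the definition brandtXi) are bounds on minimal-degree data, in the
same `(∀ D', D.deg ≤ D'.deg) →` idiom as SmallPrimePartOfDegree; this item plus
FreyParametrizationExists closes them up to X. Sources: route thesis (DefiniteXi rev 1), Murty 1999
doi:10.1090/pspum/066.1/1703750 (degree conjecture ⟹ abc frame). -/
@[route_item "route-ABC-DefiniteXi", crux]
def MinimalBoundGivesTarget : Prop :=
  (∀ a b : ℤ, IsCoprime a b → a * b * (a + b) ≠ 0 → ∀ (N : ℕ) [NeZero N], (Literature.NumberTheory.EllipticCurves.freyCurve a b).conductorNorm ℤ = N → Nonempty (Literature.NumberTheory.EllipticCurves.ModularForms.ModularParametrizationData (Literature.NumberTheory.EllipticCurves.freyCurve a b) N)) → (∀ ε : ℝ, 0 < ε → ∃ C : ℝ, ∀ a b : ℤ, IsCoprime a b → a * b * (a + b) ≠ 0 → ∀ (N : ℕ) [NeZero N], (Literature.NumberTheory.EllipticCurves.freyCurve a b).conductorNorm ℤ = N → ∀ D : Literature.NumberTheory.EllipticCurves.ModularForms.ModularParametrizationData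 (Literature.NumberTheory.EllipticCurves.freyCurve a b) N, (∀ D' : Literature.NumberTheory.EllipticCurves.ModularForms.ModularParametrizationData (Literature.NumberTheory.EllipticCurves.freyCurve a b) N, D.deg ≤ D'.deg) → (D.deg : ℝ) ≤ C * (N : ℝ) ^ (2 + ε)) → FreyDegreeBound

-- `MinimalBoundGivesTarget` holds: proved by `Summit.ABC.ABC.Theorems.minimalBoundGivesTarget_proof` (its module imports this route file, so no `_holds` link can be stated here).

-- earlier Assembly (stmt-ABC-2020, replaced 2026-08-15T17:08:17Z -> stmt-ABC-11339): retired by None — FreyDegreeBound → DegreeBoundToABC → ABC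
/-- item stmt-ABC-11339 · assembly · rank 1 · closed · proved by Summit.ABC.ABC.Theorems.assembly_proof @ a2fb378432be (prover) · by planner
[assembly] Mirrors the deciding theorem `closes` (D-0027 §2.1): XiStrongBound →
DefiniteRTControlPrime → DefiniteGlue → FreyModularity → MinimalBoundGivesTarget →
PeterssonLowerBound → DegreeBoundToABCOfPetersson → ABC; provable at once by `fun hXS hRT hGlue hMod
hMin hP hDeg => hDeg hP (hMin hMod (hGlue hXS hRT))` (Sketch4.lean rc0). Restated 2026-08-15 from
the legacy frame X → (X → ABC) → ABC when the unconditional DegreeBoundToABC was dropped. -/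
@[route_item "route-ABC-DefiniteXi"]
def Assembly : Prop :=
  XiStrongBound → DefiniteRTControlPrime → DefiniteGlue → FreyModularity → MinimalBoundGivesTarget → PeterssonLowerBound → DegreeBoundToABCOfPetersson → ABC

-- `Assembly` holds: proved by `Summit.ABC.ABC.Theorems.assembly_proof` @ a2fb378432be (its module imports this route file, so no `_holds` link can be stated here).

-- records of items no longer active in this route (dropped / restated):
-- earlier DefiniteRTControl (stmt-ABC-2022, replaced 2026-08-15T17:08:17Z -> stmt-ABC-11338): retired by None — ∀ ε : ℝ, 0 < ε → ∃ C : ℝ, ∀ a b : ℤ, IsCoprime a b → a * b * (a + b) ≠ 0 → ∀ (N : ℕ) [NeZero N], (Literature.NumberTheory.EllipticCurves.freyCurve a b).conductorNorm ℤ = N → ∀ Nm : ℕ, Odd Nm → Squarefree Nm → Odd Nm.primeFactors.card → Nm ∣ N → ∀ D : Literature.NumberTheory.EllipticCurves.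

/-! D-0027 §2.1 — DECIDING THEOREM (planner-authored via `route open/edit --closes-file`; by planner-rrepair-ABC-DefiniteXi-judge-fb38d020-0 2026-08-16T07:30:23Z):
its hypotheses are this route's items and its conclusion the sub-problem Statement (glue_lint), and it elaborates with this file. -/

@[closes "route-ABC-DefiniteXi"] theorem closes (hEis : EisensteinQuarantine) (hCore : SteinbergCore) (hRT : DefiniteRTControlPrime)
    (hGlue : DefiniteGlue) (hMod : FreyModularity) (hMin : MinimalBoundGivesTarget) (hP : PeterssonLowerBound)
    (hDeg : DegreeBoundToABCOfPetersson) : _root_.ABC := by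
  -- D-0027 §2.1 deciding theorem of route DefiniteXi (re-wired by the judge-pass route repair, 2026-08-16). The
  -- definite-quaternion line decides `ABC` through TWO cruxes neither of which is abc-equivalent on its own:
  -- `EisensteinQuarantine` (crux r5, abc-FREE: the {2,3}-part of the quarantined congruence number ξ(E;N/N⁻,N⁻) is
  -- ≤ C_ε N^ε times the level-lowering content ∏_{q ∣ N, q ∤ N⁻} v_q(Δ_min) of the non-quarantined bad primes — an
  -- index statement about the 2-/3-adic Eisenstein component of the N⁻-new definite Hecke algebra) and `SteinbergCore`
  -- (crux r6, abc-strength: the prime-to-6 part of ξ times the full exponent product ∏_{q ∣ N} v_q(Δ_min) is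
  -- ≤ C_ε N^(2+ε) — for ℓ ≥ 5 a Steinberg adjoint-Selmer product bound).  Their conjunction gives the former binder
  -- `XiStrongBound` (crux r4: ξ·∏_{q∣N⁻} v_q(Δ_min) ≤ C N^(2+ε), abc-equivalent) by PURE ALGEBRA, proved inline below:
  -- ξ = sixPart ξ · coprimeSixPart ξ and ∏_{q∣N} v_q = (∏_{q∣N, q∤N⁻} v_q)·(∏_{q∣N⁻} v_q).  From there the chain is
  -- unchanged: `DefiniteRTControlPrime` (known for N⁻ = q prime, Takahashi 2001 Thm 2.3/3.8) and the proved glue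
  -- `DefiniteGlue` give the degree bound for minimal data; `FreyModularity` and `MinimalBoundGivesTarget` turn it into
  -- the thesis X = `FreyDegreeBound`; `PeterssonLowerBound` (Hoffstein–Lockhart) and `DegreeBoundToABCOfPetersson`
  -- (Frey–Mai–Murty) turn X into `ABC`.
  -- Step 1 (pure algebra): EisensteinQuarantine ∧ SteinbergCore ⟹ XiStrongBound.
  have hXS : XiStrongBound := by
    intro ε hε
    obtain ⟨C₁, hC₁⟩ := hEis (ε / 2) (by linarith)
    obtain ⟨C₂, hC₂⟩ := hCore (ε / 2) (by linarith)
    refine ⟨max C₁ 0 * max C₂ 0, ?_⟩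
    intro a b hab h0 N _ hN Nm hodd hsq hcard hdvd
    have hA' := hC₁ a b hab h0 N hN Nm hodd hsq hcard hdvd
    have hB' := hC₂ a b hab h0 N hN Nm hodd hsq hcard hdvd
    set ξ : ℕ := Literature.NumberTheory.Automorphic.brandtXi (N / Nm) Nm
      (fun n => (Literature.NumberTheory.EllipticCurves.freyCurve a b).LFunction n) with hξ
    set s : ℕ := ordProj[2] ξ * ordProj[3] ξ with hs
    set v : ℕ → ℕ := fun q =>
      ((Literature.NumberTheory.EllipticCurves.freyCurve a b).minimalDiscriminantNorm ℤ).factorization q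
      with hv
    have hNpos : (0 : ℝ) < (N : ℝ) := by exact_mod_cast Nat.pos_of_ne_zero (NeZero.ne N)
    have hsub : Nm.primeFactors ⊆ N.primeFactors := Nat.primeFactors_mono hdvd (NeZero.ne N)
    -- sixPart ξ ∣ ξ, hence ξ = s * (ξ / s)
    have hsdvd : s ∣ ξ := by
      rcases Nat.eq_zero_or_pos ξ with h0ξ | _
      · rw [h0ξ]; exact dvd_zero _
      · exact Nat.Coprime.mul_dvd_of_dvd_of_dvd
          (Nat.Coprime.pow _ _ (by norm_num : Nat.Coprime 2 3)) (Nat.ordProj_dvd ξ 2) (Nat.ordProj_dvd ξ 3)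
    have hsc : (ξ : ℝ) = (s : ℝ) * ((ξ / s : ℕ) : ℝ) := by
      have : s * (ξ / s) = ξ := Nat.mul_div_cancel' hsdvd
      exact_mod_cast this.symm
    -- ∏_{q ∣ N} v_q = ∏_{q ∣ N, q ∤ Nm} v_q * ∏_{q ∣ Nm} v_q
    have hprod : ((∏ q ∈ N.primeFactors, v q : ℕ) : ℝ)
        = ((∏ q ∈ N.primeFactors \ Nm.primeFactors, v q : ℕ) : ℝ) * ∏ q ∈ Nm.primeFactors, ((v q : ℕ) : ℝ) := by
      rw [← Nat.cast_prod, ← Nat.cast_mul, Finset.prod_sdiff hsub]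
    have hL : (0 : ℝ) ≤ ((∏ q ∈ N.primeFactors \ Nm.primeFactors, v q : ℕ) : ℝ) := by positivity
    have hM : (0 : ℝ) ≤ ∏ q ∈ Nm.primeFactors, ((v q : ℕ) : ℝ) := by positivity
    have hc : (0 : ℝ) ≤ ((ξ / s : ℕ) : ℝ) := by positivity
    have hrpow1 : (0 : ℝ) ≤ (N : ℝ) ^ (ε / 2) := Real.rpow_nonneg hNpos.le _
    have hrpow2 : (0 : ℝ) ≤ (N : ℝ) ^ (2 + ε / 2) := Real.rpow_nonneg hNpos.le _
    have hC₁0 : (0 : ℝ) ≤ max C₁ 0 := le_max_right _ _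
    have hC₂0 : (0 : ℝ) ≤ max C₂ 0 := le_max_right _ _
    have hA'' : (s : ℝ) ≤ max C₁ 0 * (N : ℝ) ^ (ε / 2) *
        ((∏ q ∈ N.primeFactors \ Nm.primeFactors, v q : ℕ) : ℝ) := by
      refine le_trans hA' ?_
      gcongr
      exact le_max_left _ _
    have hB'' : ((ξ / s : ℕ) : ℝ) * ((∏ q ∈ N.primeFactors, v q : ℕ) : ℝ) ≤
        max C₂ 0 * (N : ℝ) ^ (2 + ε / 2) := by
      refine le_trans hB' ?_
      gcongr
      exact le_max_left _ _
    have hNsplit : (N : ℝ) ^ (ε / 2) * (N : ℝ) ^ (2 + ε / 2) = (N : ℝ) ^ (2 + ε) := by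
      rw [← Real.rpow_add hNpos]; ring_nf
    calc (ξ : ℝ) * ∏ q ∈ Nm.primeFactors, ((v q : ℕ) : ℝ)
        = (s : ℝ) * (((ξ / s : ℕ) : ℝ) * ∏ q ∈ Nm.primeFactors, ((v q : ℕ) : ℝ)) := by rw [hsc]; ring
      _ ≤ (max C₁ 0 * (N : ℝ) ^ (ε / 2) * ((∏ q ∈ N.primeFactors \ Nm.primeFactors, v q : ℕ) : ℝ))
            * (((ξ / s : ℕ) : ℝ) * ∏ q ∈ Nm.primeFactors, ((v q : ℕ) : ℝ)) := by
          gcongr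
      _ = max C₁ 0 * (N : ℝ) ^ (ε / 2) * (((ξ / s : ℕ) : ℝ) * ((∏ q ∈ N.primeFactors, v q : ℕ) : ℝ)) := by
          rw [hprod]; ring
      _ ≤ max C₁ 0 * (N : ℝ) ^ (ε / 2) * (max C₂ 0 * (N : ℝ) ^ (2 + ε / 2)) := by
          gcongr
      _ = max C₁ 0 * max C₂ 0 * (N : ℝ) ^ (2 + ε) := by rw [← hNsplit]; ring
  -- Step 2 (modus ponens through the proved glue and the frame).
  exact hDeg hP (hMin hMod (hGlue hXS hRT))

end Summit.ABC.ABC.Theses.DefiniteXi
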